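import Summits.QuantumFields.BalabanUV.Beta.D1BFx.PackedAveragingVertex
import Summits.QuantumFields.BalabanUV.Beta.D1BFx.GhostAveragingSquare

/-!
# `BalabanUV.Beta.D1BFx.PackedAveragingTable` — road «BF-x» for binder row D1, slot (K), (J3)'s (C3) rows «THE FOUR `Q′`-WORDS, m-UNIFORM MASS»,
# FILE ε1b «PACKED AVERAGING TABLE»: **THE PACKED `Q′*Q′` TABLE `Σ_κ Σ_l wsum (w κ) (u ↦ wsum (w′ l) (v′ ↦ c•qSqAt ρ n κ u l v′))` IS THE POINTWISE PRODUCT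
# `c·(qV ρ n w ⊙ qV ρ n w′)` OF THE TWO PACKED AVERAGING CURRENTS, AND ITS TOTAL MASS CARRIES THE SEPARATION OF THE TWO CENTRES** (the tadpole letter of the (C3) count)

HONEST DEPENDENCY (cell records, verbatim): «continuum YM on T⁴ ⇐ BetaPertH ∧ nine spine estimates (0/9 proved); BetaPertH ⇐ (D1) ∧ (D4) ∧
CAP+tail; G-an2-4 gates asym, D1 and NE2/3/4.»  HONEST FRAMING (cell contract, verbatim): «discharging `BetaPertH` makes Bałaban's UV stability
UNCONDITIONAL — a real constructive-QFT result; it is NOT the continuum limit and NOT the Clay problem.»  THIS MODULE DISCHARGES NOTHING of the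
wall: [folklore] `tsum` algebra (constants leave a `tsum`; `GhostAveragingSquare.qSqAt_apply`: the square table is the pointwise product of the two stripped jets) and
`ℓ¹` bookkeeping in the α1∕α2 currency on ε1's letters (`abs_qV_le`, `rows_qV`) with δ1's `CoframeWordShapes.tsum_prodWeight_le` BY NAME.  No definition, no
`def … : Prop`, nothing cited, 0 sorry.  0 root-level binders of row D1 discharged (hW ∕ hR-sockets ∕ hSX-socket ∕ D1Tel ∕ D1Rep = 0); (C3) NOT closed here; (K) NOT
closed; NOT D1, NOT `BetaPertH`, NOT continuum, NOT Clay.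

ABSOLUTE RULE (cell charter, verbatim): «No internally-minted statement may enter as a cited fact. Every hypothesis is either kernel-proved in
this package or a verbatim quotation of a PUBLISHED theorem with page reference. The manuscript(s) under audit are NOT citable for their own
disputed steps — they are the thing under adjudication; programme-internal (2001/route/tribunal) claims are never citable.»

WHY (W-2 l.45546; OWNER d1-p2 g20 PART 16 `hMRB hCB`).  The tadpole word of `BR n` is `½·tadpole (Ggh n a) 𝒲` with the packed second-order averaging table
`𝒲 = Σ_κ Σ_l wsum (W c 0 κ) (u ↦ wsum (W e z l) (v′ ↦ (a·n⁴)•qSqAt ρ n κ u l v′))`; since `qSqAt ρ n κ u l v′ = qAntiAt ρ n κ u · qAntiAt ρ n l v′` POINTWISE, the double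
packing factorises: `𝒲(x,z) = (a·n⁴)·qV ρ n (W c 0) (x,z)·qV ρ n (W e z) (x,z)` — two rank-two currents of ε1 on a common block, the first read pointwise (`≍ n⁻⁷`), the
second by its rows (`≍ n⁻³`), the two envelopes meeting on the rows' site give `Zl 4 (δ−θ)·e^{−θ|P−P′|₁}`: total mass `≍ n⁴·n⁻⁷·n⁻³·n⁴ = n⁻²` at the road's letters.

CONTENT (all [folklore]; weights `w, w′ : Fin 4 → Site 4 → ℝ` with envelopes `C·e^{−δ|u−P|₁}`, `C′·e^{−δ|u−P′|₁}`).
* **`wsum_smul_qSqAt`** (one bond pair), **`sum_sum_wsum_qSqAt`** (`Σ_κ Σ_l wsum (w κ) (u ↦ wsum (w′ l) (v′ ↦ c•qSqAt ρ n κ u l v′)) = (x z ↦ c·(qV ρ n w x z·qV ρ n w′ x z))`,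
  NO hypothesis), **`totMass_qTable`** (`0 ≤ θ < δ`: `TotMass (x z ↦ c·(qV w x z·qV w′ x z)) (|c|·(8n·(n⁴)⁻¹·C·e^{8nδ})·(8n·C′·e^{8nδ})·Zl 4 (δ−θ)·e^{−θ|P−P′|₁})`).
NOT HERE: the words (ε2), the scales (ε3).
Unit `b2b-balaban-gan24-formalise-leaf-05` (gen 55), G-an2-4 swarm leaf prover 05, road «BF-x» supplier; INTENT «(C3) DIRECT» ε1b (journal).
-/

noncomputable section

namespace Summit.QuantumFields.BalabanUV.Beta.D1BFx.PackedAveragingTable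

open Finset
open scoped BigOperators
open Literature.MathematicalPhysics.QuantumFieldTheory.Balaban1983to89
open Literature.MathematicalPhysics.QuantumFieldTheory.Balaban1983to89.Beta
open B12Sec2to5 (l1 l1_nonneg)
open ExpKernelCalculus (Site MKer Zl Zl_pos l1_sub_triangle l1_sub_symm)
open OneStepResolventKernel (wsum)
open Summit.QuantumFields.BalabanUV.Beta.D1BFx.GhostStencilRooted (qAntiAt)
open Summit.QuantumFields.BalabanUV.Beta.D1BFx.GhostAveragingSquare (qSqAt qSqAt_apply)
open Summit.QuantumFields.BalabanUV.Beta.D1BFx.GhostLegMasses (rowFn_unit)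
open Summit.QuantumFields.BalabanUV.Beta.D1BFx.CoframeVertices (const_nonneg)
open Summit.QuantumFields.BalabanUV.Beta.D1BFx.KernelMassCalculus
open Summit.QuantumFields.BalabanUV.Beta.D1BFx.KernelMassTotal
open Summit.QuantumFields.BalabanUV.Beta.D1BFx.PackedAveragingVertex

/-! ## §4 The packed `Q′*Q′` table is the pointwise product of two packed currents -/

section Table

variable (ρ : Site 4) (n : ℕ) [NeZero n] (w w' : Fin 4 → Site 4 → ℝ)

omit [NeZero n] in
/-- [folklore] One bond pair: `wsum (w′ l) (v′ ↦ c•qSqAt ρ n κ u l v′) x z = c·qAntiAt ρ n κ u x z·wsum (w′ l) (qAntiAt ρ n l) x z` (`qSqAt` is the pointwise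
product of the two stripped jets, `GhostAveragingSquare.qSqAt_apply`; constants leave the `tsum`). -/
theorem wsum_smul_qSqAt (c : ℝ) (κ : Fin 4) (u : Site 4) (l : Fin 4) (x z : Site 4) (a b : Unit) :
    wsum (w' l) (fun v' => c • qSqAt ρ n κ u l v') x z a b = c * qAntiAt ρ n κ u x z () () * wsum (w' l) (qAntiAt ρ n l) x z () () := by
  simp only [wsum, Pi.smul_apply, smul_eq_mul, qSqAt_apply]
  rw [← tsum_mul_left]
  exact tsum_congr fun v' => by ring

omit [NeZero n] in
/-- [folklore] **THE PACKED `Q′*Q′` TABLE IS THE POINTWISE PRODUCT OF THE TWO PACKED CURRENTS**: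
`Σ_κ Σ_l wsum (w κ) (u ↦ wsum (w′ l) (v′ ↦ c•qSqAt ρ n κ u l v′)) = (x z ↦ c·(qV ρ n w x z·qV ρ n w′ x z))` — no hypothesis (pure `tsum` algebra). -/
theorem sum_sum_wsum_qSqAt (c : ℝ) :
    (∑ κ : Fin 4, ∑ l : Fin 4, wsum (w κ) (fun u => wsum (w' l) (fun v' => c • qSqAt ρ n κ u l v')))
      = fun x z a b => c * (qV ρ n w x z a b * qV ρ n w' x z a b) := by
  funext x z a b
  cases a; cases b
  simp only [Finset.sum_apply]
  have eκl : ∀ κ l : Fin 4, wsum (w κ) (fun u => wsum (w' l) (fun v' => c • qSqAt ρ n κ u l v')) x z () ()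
      = (c * wsum (w' l) (qAntiAt ρ n l) x z () ()) * wsum (w κ) (qAntiAt ρ n κ) x z () () := by
    intro κ l
    have h : ∀ u : Site 4, wsum (w' l) (fun v' => c • qSqAt ρ n κ u l v') x z () ()
        = c * qAntiAt ρ n κ u x z () () * wsum (w' l) (qAntiAt ρ n l) x z () () := fun u => wsum_smul_qSqAt ρ n w' c κ u l x z () ()
    show (∑' u : Site 4, w κ u * wsum (w' l) (fun v' => c • qSqAt ρ n κ u l v') x z () ())
        = (c * wsum (w' l) (qAntiAt ρ n l) x z () ()) * ∑' u : Site 4, w κ u * qAntiAt ρ n κ u x z () ()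
    simp only [h]
    rw [← tsum_mul_left]
    exact tsum_congr fun u => by ring
  simp only [eκl]
  show (∑ κ : Fin 4, ∑ l : Fin 4, (c * wsum (w' l) (qAntiAt ρ n l) x z () ()) * wsum (w κ) (qAntiAt ρ n κ) x z () ())
      = c * ((∑ κ : Fin 4, wsum (w κ) (qAntiAt ρ n κ) x z () ()) * ∑ l : Fin 4, wsum (w' l) (qAntiAt ρ n l) x z () ())
  rw [Finset.sum_mul_sum, Finset.mul_sum]
  refine Finset.sum_congr rfl fun κ _ => ?_
  rw [Finset.mul_sum]
  exact Finset.sum_congr rfl fun l _ => by ring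

variable {w w'} {C C' δ θ : ℝ} {P P' : Site 4}

/-- [folklore] **TOTAL MASS OF THE PACKED `Q′*Q′` TABLE, WITH THE SEPARATION OF THE TWO CENTRES**: for weight envelopes at `P`, `P′` (common rate `δ`) and
`0 ≤ θ < δ`, `TotMass (x z ↦ c·(qV w x z·qV w′ x z)) (|c|·(8n·(n⁴)⁻¹·C·e^{8nδ})·(8n·C′·e^{8nδ})·Zl 4 (δ−θ)·e^{−θ|P−P′|₁})` — the first current by its
pointwise size, the second by its rows, the two envelopes meeting on the rows' site (`≍ n⁴·n⁻⁷·n⁻³·n⁴ = n⁻²` at the road's weights and colour weight `a·n⁴`). -/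
theorem totMass_qTable (hw : ∀ κ u, |w κ u| ≤ C * Real.exp (-δ * l1 (u - P))) (hw' : ∀ κ u, |w' κ u| ≤ C' * Real.exp (-δ * l1 (u - P')))
    (hθ : 0 ≤ θ) (hθδ : θ < δ) (c : ℝ) :
    TotMass (fun x z a b => c * (qV ρ n w x z a b * qV ρ n w' x z a b))
      (|c| * (8 * n * ((n : ℝ) ^ 4)⁻¹ * C * Real.exp (8 * n * δ)) * (8 * n * C' * Real.exp (8 * n * δ)) * Zl 4 (δ - θ)
        * Real.exp (-θ * l1 (P - P'))) := by
  have hδ : 0 ≤ δ := hθ.trans hθδ.le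
  have hC := const_nonneg hw
  have hC' := const_nonneg hw'
  set A : ℝ := 8 * n * ((n : ℝ) ^ 4)⁻¹ * C * Real.exp (8 * n * δ) with hA
  set A' : ℝ := 8 * n * C' * Real.exp (8 * n * δ) with hA'
  have hA0 : 0 ≤ A := by positivity
  -- one row: the first current pointwise, the second current's row sum
  have hrowpt : ∀ x z, rowFn (fun x z a b => c * (qV ρ n w x z a b * qV ρ n w' x z a b)) 0 x z
      ≤ |c| * (A * Real.exp (-δ * l1 (x - P))) * rowFn (qV ρ n w') 0 x z := by
    intro x z
    rw [rowFn_unit, rowFn_unit, zero_mul, Real.exp_zero, mul_one, mul_one, abs_mul, abs_mul]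
    have h1 := abs_qV_le ρ n hw hδ x z () ()
    calc |c| * (|qV ρ n w x z () ()| * |qV ρ n w' x z () ()|)
        ≤ |c| * ((A * Real.exp (-δ * l1 (x - P))) * |qV ρ n w' x z () ()|) :=
          mul_le_mul_of_nonneg_left (mul_le_mul_of_nonneg_right h1 (abs_nonneg _)) (abs_nonneg _)
      _ = _ := by ring
  have hrow : ∀ x, Summable (rowFn (fun x z a b => c * (qV ρ n w x z a b * qV ρ n w' x z a b)) 0 x) ∧
      ∑' z, rowFn (fun x z a b => c * (qV ρ n w x z a b * qV ρ n w' x z a b)) 0 x z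
        ≤ |c| * A * A' * (Real.exp (-δ * l1 (x - P)) * Real.exp (-δ * l1 (x - P'))) := by
    intro x
    obtain ⟨hs, hle⟩ := rows_qV ρ n hw' hδ x
    have hs2 : Summable fun z => |c| * (A * Real.exp (-δ * l1 (x - P))) * rowFn (qV ρ n w') 0 x z := hs.mul_left _
    refine ⟨hs2.of_nonneg_of_le (fun z => rowFn_nonneg _ _ _ _) (hrowpt x), ?_⟩
    calc ∑' z, rowFn (fun x z a b => c * (qV ρ n w x z a b * qV ρ n w' x z a b)) 0 x z
        ≤ ∑' z, |c| * (A * Real.exp (-δ * l1 (x - P))) * rowFn (qV ρ n w') 0 x z :=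
          Summable.tsum_le_tsum (hrowpt x) (hs2.of_nonneg_of_le (fun z => rowFn_nonneg _ _ _ _) (hrowpt x)) hs2
      _ = |c| * (A * Real.exp (-δ * l1 (x - P))) * ∑' z, rowFn (qV ρ n w') 0 x z := tsum_mul_left
      _ ≤ |c| * (A * Real.exp (-δ * l1 (x - P))) * (A' * Real.exp (-δ * l1 (x - P'))) :=
          mul_le_mul_of_nonneg_left hle (by positivity)
      _ = |c| * A * A' * (Real.exp (-δ * l1 (x - P)) * Real.exp (-δ * l1 (x - P'))) := by ring
  -- the rows summed: the two envelopes meet on `x`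
  have hϖ : ∀ x, |(|c| * A * A') * (Real.exp (-δ * l1 (x - P)) * Real.exp (-δ * l1 (x - P')))|
      ≤ (|c| * A * A') * Real.exp (-δ * l1 (x - P)) * Real.exp (-δ * l1 (x - P')) := fun x => by
    rw [abs_of_nonneg (by positivity)]; exact le_of_eq (by ring)
  obtain ⟨hsum, hle⟩ := CoframeWordShapes.tsum_prodWeight_le hϖ hθ hθδ
  have hs' : Summable fun x => ∑' z, rowFn (fun x z a b => c * (qV ρ n w x z a b * qV ρ n w' x z a b)) 0 x z :=
    (hsum.of_nonneg_of_le (fun x => tsum_nonneg fun z => rowFn_nonneg _ _ _ _)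
      (fun x => ((hrow x).2).trans (le_abs_self _)))
  refine totMass_iff.2 ⟨fun x => (hrow x).1, hs', ?_⟩
  calc ∑' x, ∑' z, rowFn (fun x z a b => c * (qV ρ n w x z a b * qV ρ n w' x z a b)) 0 x z
      ≤ ∑' x, |(|c| * A * A') * (Real.exp (-δ * l1 (x - P)) * Real.exp (-δ * l1 (x - P')))| :=
        Summable.tsum_le_tsum (fun x => ((hrow x).2).trans (le_abs_self _)) hs' hsum
    _ ≤ (|c| * A * A') * Zl 4 (δ - θ) * Real.exp (-θ * l1 (P - P')) := hle
    _ = _ := by rw [hA, hA']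

end Table


end Summit.QuantumFields.BalabanUV.Beta.D1BFx.PackedAveragingTable

end
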